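import Summits.Ventures.HSemireg.WedgeWeilPuritySchur

/-!
# Venture HSemireg — W-PURITY: the generic value holds off at most ρ + 1 values of b

HONEST FRAMING. Part of the Lean index of the computation cell `pub-hsemireg` (second enclosure wave, cut by seat p6 in the
conventions of seat p3's ENCLOSURE-PLAN-p3.md / build.py from th-7's kernel assets).  Finite-dimensional exterior algebra over a field ONLY:
no variety, no cohomology theory, no semiregularity map is constructed here; nothing here says that HC / HC_CM / HC_AV holds;
no Literature fact is declared or used.  The geometric DICTIONARY (why these ranks are the `HT`-side box ranks of the cell's
STRUCTURE.md §1 / theory/FORMULA-N.md) lives in theory/FORMULA-N-th7.md PART B §A.3 / §N and is NOT asserted in Lean.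

th-7's PART S3 — THE GENERIC PURITY VALUE IS A KERNEL THEOREM (theory/th7/WPurityStructure.lean v3 ae498f7d4ae161bb, PART S3 (th-7 g7, 02:47Z 2026-08-23; ×2 farm + NC-S3 at p6 g7), the block after PART S2's `end SchurNN`),
VERBATIM up to the namespace (`HSemiregWeil` ↦ `Summit.Ventures.HSemireg.Wedge.Weil`): Weil type `(n,n)`, `m = n ≥ 1`, `a ≠ 0`, EVERY `q` (any `ρ = rank H_n(q)`), EVERY field:
**`card_exceptional_le`** — at most `ρ` NON-ZERO values of `b` make the ends kernel `Hom(Gm) n ⊓ ker(ψ₋ψ₊ − ab)` non-trivial (eigenvectors of `ψ₋ψ₊` for distinct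
eigenvalues are independent and lie in `ψ₋ψ₊(E₊)` of dimension `≤ ρ`); **`weilPurity_generic (hn : 1 ≤ n) (q) (ha : a ≠ 0)`**: `∃ s : Finset K, 0 ∈ s ∧ s.card ≤ ρ + 1 ∧
∀ b ∉ s, finrank range(wedge K (n+n) n (vW K (n+n) n q a b)) + 2ρ = C(2n,n)·ρ + (C(2n,n) + C(2n,n))` — OUTSIDE at most `ρ + 1` values of `b` the degree-`n` rank is the
GENERIC value `C(2n,n)(2+ρ) − 2ρ` of W-PURITY(ρ) (FORMULA-N PART B §L.5 (γ)).
-/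

open Module Set Set.powersetCard Summit.Ventures.HSemireg.Wedge.Hankel

namespace Summit.Ventures.HSemireg.Wedge.Weil

variable (K : Type*) [Field K]

/-! ## PART S3 (th-7 g7, 2026-08-23) — THE GENERIC PURITY VALUE IS A KERNEL THEOREM (FORMULA-N PART B §L.5 (γ))
For `a ≠ 0`: a non-zero `θ ∈ E₊ ⊓ ker(ψ₋ψ₊ − ab)` is an eigenvector of `ψ₋ψ₊` for the eigenvalue `ab`; if `b ≠ 0`
it lies in `ψ₋ψ₊(E₊)`, a space of dimension ≤ ρ (`finrank_map_psiP`); eigenvectors for distinct eigenvalues are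
linearly independent (Mathlib `Module.End.eigenvectors_linearIndependent'`). Hence **at most ρ non-zero values of
`b` are exceptional** (`card_exceptional_le`) and for every `b` outside a finite set of size ≤ ρ + 1 (containing 0)
the rank takes the GENERIC PURITY VALUE **`rank(∧v ∣ HTⁿ) = C(2n,n)·(2 + ρ) − 2ρ`** (`weilPurity_generic`),
every field, every `q`. (The identification of the ≤ ρ exceptional products `ab` with `Spec≠0((−1)ⁿ(H_nΩ_n)²)`
stays derived ×2 + exact 12/12 at n ≤ 4.) -/

section Generic

variable {n : ℕ}

/-- membership in `ker(ψ₋ψ₊ − ab·id)`: `ψ₋(ψ₊ θ) = (ab) • θ`. -/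
lemma mem_ker_schurOp_iff (q : ℕ → K) (a b : K) (θ : HT K (In (n + n))) :
    θ ∈ LinearMap.ker (schurOp K n q a b) ↔ psiM K n q (psiP K n q θ) = (a * b) • θ := by
  rw [LinearMap.mem_ker, schurOp_apply, sub_eq_zero]

/-- a kernel vector of `ψ₋ψ₊ − ab` with `ab ≠ 0` lies in `ψ₋(ψ₊(E₊))` (given `θ ∈ E₊`). -/
lemma mem_map_psiMP_of_ker {q : ℕ → K} {a b : K} (hab : a * b ≠ 0) {θ : HT K (In (n + n))}
    (hE : θ ∈ Hom K (In (n + n)) (Gm (n + n) n) n) (hk : θ ∈ LinearMap.ker (schurOp K n q a b)) :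
    θ ∈ ((Hom K (In (n + n)) (Gm (n + n) n) n).map (psiP K n q)).map (psiM K n q) := by
  rw [mem_ker_schurOp_iff] at hk
  have h : θ = (a * b)⁻¹ • psiM K n q (psiP K n q θ) := by
    rw [hk, smul_smul, inv_mul_cancel₀ hab, one_smul]
  rw [h]
  exact Submodule.smul_mem _ _ (Submodule.mem_map_of_mem (Submodule.mem_map_of_mem hE))

/-- `dim ψ₋ψ₊(E₊) ≤ ρ`. -/
lemma finrank_map_psiMP_le (q : ℕ → K) :
    Module.finrank K ↥(((Hom K (In (n + n)) (Gm (n + n) n) n).map (psiP K n q)).map (psiM K n q)) ≤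
      (hankel1 K (n + n) n q).rank :=
  calc Module.finrank K ↥(((Hom K (In (n + n)) (Gm (n + n) n) n).map (psiP K n q)).map (psiM K n q))
        ≤ Module.finrank K ↥((Hom K (In (n + n)) (Gm (n + n) n) n).map (psiP K n q)) :=
          Submodule.finrank_map_le _ _
    _ = (hankel1 K (n + n) n q).rank := finrank_map_psiP K q

/-- **AT MOST ρ NON-ZERO EXCEPTIONAL VALUES:** for `a ≠ 0`, every finite set of non-zero `b` with
`E₊ ⊓ ker(ψ₋ψ₊ − ab) ≠ ⊥` has at most `ρ = rank H_n(q)` elements. -/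
theorem card_exceptional_le (q : ℕ → K) {a : K} (ha : a ≠ 0) (s : Finset K) (hs0 : (0 : K) ∉ s)
    (hs : ∀ b ∈ s, Hom K (In (n + n)) (Gm (n + n) n) n ⊓ LinearMap.ker (schurOp K n q a b) ≠ ⊥) :
    s.card ≤ (hankel1 K (n + n) n q).rank := by
  classical
  have hex : ∀ b : s, ∃ θ : HT K (In (n + n)), θ ∈ Hom K (In (n + n)) (Gm (n + n) n) n ∧
      θ ∈ LinearMap.ker (schurOp K n q a b) ∧ θ ≠ 0 := by
    intro b
    obtain ⟨θ, hθ, hθ0⟩ := (Submodule.ne_bot_iff _).mp (hs b b.2)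
    exact ⟨θ, (Submodule.mem_inf.mp hθ).1, (Submodule.mem_inf.mp hθ).2, hθ0⟩
  choose θ hθE hθk hθ0 using hex
  -- eigenvectors of ψ₋ψ₊ for the pairwise distinct eigenvalues `a * b`
  have hev : ∀ b : s, Module.End.HasEigenvector (psiM K n q ∘ₗ psiP K n q) (a * (b : K)) (θ b) := by
    intro b
    refine Module.End.hasEigenvector_iff.mpr ⟨?_, hθ0 b⟩
    rw [Module.End.mem_eigenspace_iff, LinearMap.comp_apply]
    exact (mem_ker_schurOp_iff K q a b (θ b)).mp (hθk b)
  have hinj : Function.Injective (fun b : s => a * (b : K)) := by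
    intro b b' h
    exact Subtype.ext (mul_left_cancel₀ ha h)
  have hli : LinearIndependent K θ :=
    Module.End.eigenvectors_linearIndependent' (psiM K n q ∘ₗ psiP K n q) _ hinj θ hev
  -- all of them inside ψ₋ψ₊(E₊), of dimension ≤ ρ
  have hmem : ∀ b : s, θ b ∈ ((Hom K (In (n + n)) (Gm (n + n) n) n).map (psiP K n q)).map (psiM K n q) := by
    intro b
    have hb0 : (b : K) ≠ 0 := fun h => hs0 (h ▸ b.2)
    exact mem_map_psiMP_of_ker K (mul_ne_zero ha hb0) (hθE b) (hθk b)
  have hli' : LinearIndependent K (fun b : s =>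
      (⟨θ b, hmem b⟩ : ↥(((Hom K (In (n + n)) (Gm (n + n) n) n).map (psiP K n q)).map (psiM K n q)))) :=
    LinearIndependent.of_comp (Submodule.subtype _) (by exact hli)
  have hcard := hli'.fintype_card_le_finrank
  rw [Fintype.card_coe] at hcard
  exact hcard.trans (finrank_map_psiMP_le K q)

/-- **THE GENERIC PURITY VALUE (Weil type (n,n), m = n ≥ 1, a ≠ 0; every q, every field).** There is a finite
exceptional set `s ∋ 0` of at most `ρ + 1` values such that for every `b ∉ s`
`rank(∧v ∣ HTⁿ) = C(2n,n)·(2 + ρ) − 2ρ`, stated additively: `finrank range + 2ρ = C(2n,n)·ρ + 2·C(2n,n)`. -/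
theorem weilPurity_generic (hn : 1 ≤ n) (q : ℕ → K) {a : K} (ha : a ≠ 0) :
    ∃ s : Finset K, (0 : K) ∈ s ∧ s.card ≤ (hankel1 K (n + n) n q).rank + 1 ∧ ∀ b ∉ s,
      Module.finrank K (LinearMap.range (wedge K (n + n) n (vW K (n + n) n q a b))) +
          2 * (hankel1 K (n + n) n q).rank =
        (n + n).choose n * (hankel1 K (n + n) n q).rank + ((n + n).choose n + (n + n).choose n) := by
  classical
  -- the candidate non-zero exceptional values: `a⁻¹ μ`, `μ` an eigenvalue of ψ₋ψ₊ (a finite set), filtered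
  set T : Module.End K (HT K (In (n + n))) := psiM K n q ∘ₗ psiP K n q with hT
  set s' : Finset K := (Finset.univ.image (fun μ : T.Eigenvalues => a⁻¹ * (μ : K))).filter
    (fun b => b ≠ 0 ∧ Hom K (In (n + n)) (Gm (n + n) n) n ⊓ LinearMap.ker (schurOp K n q a b) ≠ ⊥) with hs'
  refine ⟨insert 0 s', Finset.mem_insert_self _ _, ?_, ?_⟩
  · have h1 : s'.card ≤ (hankel1 K (n + n) n q).rank :=
      card_exceptional_le K q ha s' (fun h => (Finset.mem_filter.mp h).2.1 rfl)
        (fun b hb => (Finset.mem_filter.mp hb).2.2)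
    exact (Finset.card_insert_le _ _).trans (by omega)
  · intro b hb
    rw [Finset.mem_insert, not_or] at hb
    obtain ⟨hb0, hbs⟩ := hb
    have hbot : Hom K (In (n + n)) (Gm (n + n) n) n ⊓ LinearMap.ker (schurOp K n q a b) = ⊥ := by
      by_contra hne
      apply hbs
      refine Finset.mem_filter.mpr ⟨?_, hb0, hne⟩
      obtain ⟨θ, hθ, hθ0⟩ := (Submodule.ne_bot_iff _).mp hne
      have hev : T.HasEigenvalue (a * b) := by
        refine Module.End.hasEigenvalue_of_hasEigenvector (x := θ)
          (Module.End.hasEigenvector_iff.mpr ⟨?_, hθ0⟩)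
        rw [Module.End.mem_eigenspace_iff, hT, LinearMap.comp_apply]
        exact (mem_ker_schurOp_iff K q a b θ).mp (Submodule.mem_inf.mp hθ).2
      refine Finset.mem_image.mpr ⟨⟨a * b, hev⟩, Finset.mem_univ _, ?_⟩
      show a⁻¹ * (a * b) = b
      rw [← mul_assoc, inv_mul_cancel₀ ha, one_mul]
    have h := weilPurity_schur K hn q ha b
    rw [hbot, finrank_bot] at h
    omega

end Generic

end Summit.Ventures.HSemireg.Wedge.Weil
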